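import Summits.QuantumFields.YangMills.Theorems.FluctuationComparisonRegPrIntLS2BetaRelativeTentKernel
import Summits.QuantumFields.YangMills.Theorems.FluctuationComparisonRegPrIntLS2BetaOneLevelStepLetters
import Literature.Analysis.Complex.RungeUnits
import HarnessLib

/-!
# S2β · letter (D♮) REL-TEL, the (C)-half — THE RELATIVE MEMBER LETTERS OF THE RELATIVE (C)-STEP (glue between BRICKS 1–3, the Cauchy letters and the assembly):
# the `SU(N)` relative currency `dist1 (X₀⁻¹X) = ‖X − X₀‖`, `log` and `exp` as Lipschitz maps near `1`, the relative COUPLED members (conjugation by relative transports costs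
# SIZE × ARC), and the RELATIVE MAIN TERM IN LOG CURRENCY `mean_i ‖log(S_i□_iS_i⁻¹)(U) − log(S_i□_iS_i⁻¹)(U₀)‖ ≤ (1 + 2τ)·(Σ_p K·δ_p + 4L³θ·γ + 2L²θ·β)`

Cell `ym3-torus` (rung R3 = continuum `SU(2)` Yang–Mills on the three-torus — NOT d = 4, NOT infinite volume, NOT a mass gap, NOT Clay).
Width seat «width 10» `ym3-torus-px10` (gen 23), FREE px helper on crux `stmt-QuantumFields-20520`, count-neutral, DEFINITION-FREE; own-risk brick of the px10 lane
«(C)-half of letter (D♮)» (px16 g21 «GO BRICK 1» 11:28:01Z, «GO (R-Cauchy)» 12:12:40Z; UV3-NODE §82).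

CONTENT.
* §1 `SU(N)` currency: `norm_coe_sub_coe_eq_dist1_rel` (`‖X − X₀‖ = dist1 (X₀⁻¹X)`), `norm_mlog_sub_mlog_le_two_mul_dist1` (`‖log X − log X₀‖ ≤ 2·dist1 (X₀⁻¹X)` when both are within
  `1∕2` of `1`; lit ✓`FederbushMean.norm_mlog_sub_mlog_le`), ★`dist1_rel_le_mul_norm_mlog_sub` (`dist1 (X₀⁻¹X) ≤ e^{m}·‖log X − log X₀‖` when `‖log X‖, ‖log X₀‖ ≤ m`, both inside
  `log`'s ball; lit ✓`Literature.Analysis.Complex.norm_exp_sub_exp_le` + ✓`exp_mlog`).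
* §2 relative coupled members (any `GaugeGroup` with the commutator letter): `dist1_rel_conj_le'` (`δ(TℓT⁻¹) ≤ δ(ℓ) + 2·dist1 ℓ·δ(T)`) and `dist1_rel_conj_inv_le`
  (`δ(Tℓ⁻¹T⁻¹) ≤ δ(ℓ) + 2·dist1 ℓ·δ(T)`), `dist1_rel_prod3_le` ∕ `dist1_rel_prod4_le` (`δ(A₁A₂A₃⁻¹) ≤ Σδ(A_m)`, `δ(A₁A₂A₃⁻¹A₄⁻¹) ≤ Σδ(A_m)`).
* §3 ★★ `mean_norm_mlog_conjRect_sub_le` — THE RELATIVE MAIN TERM IN LOG CURRENCY (`SU(N)`): for `PlaqSmall θ U`, `PlaqSmall θ U₀`, `L²θ ≤ 1∕2`, relative staircase transports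
  `δ(S_i) ≤ β` and forward-near bond deviations `≤ γ`:
  `|Idx|⁻¹·Σ_i ‖log(S_i(U)·□_i(U)·S_i(U)⁻¹) − log(S_i(U₀)·□_i(U₀)·S_i(U₀)⁻¹)‖ ≤ (1 + 2L²θ)·(Σ_p K Q p·δ_p + 4L³θ·γ + 2L²θ·β)` (✓BRICK 1 `dist1_rel_conj_le` + ✓BRICK 2
  `mean_dist1_rect_rel_le_tentKernel_of_local` + §1).

HONEST SCOPE.  Banach-algebra ∕ group bookkeeping over landed letters; nothing of Bałaban's renormalisation analysis is asserted; the relative (C)-step's assembly, the relative key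
lemma, (D♮), (F♮), GAP♯∘ (`stub_uniformFibreGapOrbit`), S2β, crux 20520 and `YM3TorusSU2` are NOT proved; no registered stub is closed; the Yang–Mills mass gap is NOT proved.
Sorry-free, axioms standard.
References: T. Bałaban, CMP **98** (1985) 17–51 [Balaban1985Averaging] ((19) p.21, (21) p.21, (26)–(27) p.22); CMP **109** (1987) 249–301 [Balaban1987RG1] ((0.4) p.253).
-/

set_option autoImplicit false

noncomputable section

namespace Summit.QuantumFields.YangMills.Theorems.FluctuationComparisonRegPrIntLS2BetaRelativeMemberLetters

open NormedSpace Finset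
open scoped BigOperators Matrix.Norms.L2Operator
open Literature.MathematicalPhysics.QuantumFieldTheory.Balaban1983to89
open Literature.MathematicalPhysics.QuantumFieldTheory.Balaban1983to89.T4Continuum
open Literature.MathematicalPhysics.QuantumFieldTheory.Balaban1983to89.BlockAveraging
open Literature.MathematicalPhysics.QuantumFieldTheory.Balaban1983to89.MatrixLog (mlog exp_mlog)
open Literature.MathematicalPhysics.QuantumFieldTheory.Balaban1983to89.T4TiltOscillation (bdev dist1_mul_comm)
open B10Eq47AxialChi (shiftN rect)
open Summit.QuantumFields.YangMills.Theorems.FluctuationComparisonRegPrIntLS2BetaRelativeStokes (dist1_rel_comm dist1_rel_mul_le dist1_rel_inv dist1_rel_conj_le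
  dist1_comm_le_SU)
open Summit.QuantumFields.YangMills.Theorems.FluctuationComparisonRegPrIntLS2BetaRelativeTentKernel (mean_dist1_rect_rel_le_tentKernel_of_local)
open Summit.QuantumFields.YangMills.Theorems.FluctuationComparisonRegPrIntLS2BetaOneLevelStepLetters (norm_mean_le_mean dist1_rect_le_sq_mul)

variable {P : Params} {j : ℕ}

/-! ## §1 The `SU(N)` relative currency; `log` and `exp` as Lipschitz maps near `1` -/

section SU

variable {n : Type*} [Fintype n] [DecidableEq n] [Nonempty n]

/-- **THE RELATIVE SIZE IS THE MATRIX DIFFERENCE**: `‖X − X₀‖ = dist1 (X₀⁻¹·X)` on `SU(N)` (`dist1 = ‖· − 1‖` by `rfl`, left multiplication by the unitary `X₀⁻¹`). [folklore] -/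
theorem norm_coe_sub_coe_eq_dist1_rel (X X₀ : Matrix.specialUnitaryGroup n ℂ) :
    ‖(X : Matrix n n ℂ) - (X₀ : Matrix n n ℂ)‖ = dist1 (X₀⁻¹ * X) := by
  have hu : ((X₀⁻¹ : Matrix.specialUnitaryGroup n ℂ) : Matrix n n ℂ) ∈ Matrix.unitaryGroup n ℂ := Matrix.specialUnitaryGroup_le_unitaryGroup (X₀⁻¹).2
  have h1 : ((X₀⁻¹ : Matrix.specialUnitaryGroup n ℂ) : Matrix n n ℂ) * (X₀ : Matrix n n ℂ) = 1 := by
    rw [← Submonoid.coe_mul, inv_mul_cancel]; rfl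
  have e : ((X₀⁻¹ * X : Matrix.specialUnitaryGroup n ℂ) : Matrix n n ℂ) - 1 =
      ((X₀⁻¹ : Matrix.specialUnitaryGroup n ℂ) : Matrix n n ℂ) * ((X : Matrix n n ℂ) - (X₀ : Matrix n n ℂ)) := by
    rw [Submonoid.coe_mul, mul_sub, h1]
  rw [FederbushMean.dist1_SU_eq, e, CStarRing.norm_mem_unitary_mul _ hu]

/-- `‖log X − log X₀‖ ≤ 2·dist1 (X₀⁻¹X)` when `dist1 X, dist1 X₀ ≤ 1∕2` (lit ✓`FederbushMean.norm_mlog_sub_mlog_le` at `ρ = 1∕2`). [cite: Balaban1985Averaging, (21) p.21] -/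
theorem norm_mlog_sub_mlog_le_two_mul_dist1 (X X₀ : Matrix.specialUnitaryGroup n ℂ) (hX : dist1 X ≤ 1 / 2) (hX₀ : dist1 X₀ ≤ 1 / 2) :
    ‖mlog (X : Matrix n n ℂ) - mlog (X₀ : Matrix n n ℂ)‖ ≤ 2 * dist1 (X₀⁻¹ * X) := by
  rw [FederbushMean.dist1_SU_eq] at hX hX₀
  have h := FederbushMean.norm_mlog_sub_mlog_le (ρ := 1 / 2) (by norm_num) hX hX₀
  rw [← norm_coe_sub_coe_eq_dist1_rel]
  refine h.trans (le_of_eq ?_)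
  norm_num

/-- ★ **THE EXIT: RELATIVE SIZE FROM RELATIVE LOGARITHM**: if `dist1 X, dist1 X₀ < 1` and `‖log X‖, ‖log X₀‖ ≤ m` then `dist1 (X₀⁻¹X) ≤ e^{m}·‖log X − log X₀‖`
(`X = e^{log X}`, lit ✓`exp_mlog`; `‖e^{A} − e^{B}‖ ≤ ‖A − B‖·e^{max ‖A‖ ‖B‖}`, lit ✓`Literature.Analysis.Complex.norm_exp_sub_exp_le`). [cite: Balaban1985Averaging, (21) p.21] -/
theorem dist1_rel_le_mul_norm_mlog_sub (X X₀ : Matrix.specialUnitaryGroup n ℂ) (hX : dist1 X < 1) (hX₀ : dist1 X₀ < 1) {m : ℝ}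
    (hm : ‖mlog (X : Matrix n n ℂ)‖ ≤ m) (hm₀ : ‖mlog (X₀ : Matrix n n ℂ)‖ ≤ m) :
    dist1 (X₀⁻¹ * X) ≤ Real.exp m * ‖mlog (X : Matrix n n ℂ) - mlog (X₀ : Matrix n n ℂ)‖ := by
  rw [FederbushMean.dist1_SU_eq] at hX hX₀
  rw [← norm_coe_sub_coe_eq_dist1_rel, ← exp_mlog hX, ← exp_mlog hX₀, exp_mlog hX, exp_mlog hX₀]
  have h := Literature.Analysis.Complex.norm_exp_sub_exp_le (mlog (X : Matrix n n ℂ)) (mlog (X₀ : Matrix n n ℂ))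
  rw [exp_mlog hX, exp_mlog hX₀] at h
  refine h.trans ?_
  rw [mul_comm]
  exact mul_le_mul_of_nonneg_right (Real.exp_le_exp.mpr (max_le hm hm₀)) (norm_nonneg _)

end SU

/-! ## §2 Relative coupled members: conjugation by relative transports costs SIZE × ARC -/

section Group

variable {G : Type*} [GaugeGroup G]

/-- `δ(T·ℓ·T⁻¹) ≤ δ(ℓ) + 2·dist1 ℓ·δ(T)` (✓BRICK 1 `dist1_rel_conj_le`, restated with the relative sizes as hypotheses). [folklore] -/
theorem dist1_rel_conj_le' (hcomm : ∀ g h : G, dist1 (g * h * g⁻¹ * h⁻¹) ≤ 2 * dist1 g * dist1 h) {ℓ ℓ₀ T T₀ : G} {τ β t : ℝ}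
    (hℓ : dist1 ℓ ≤ τ) (hβ : dist1 (ℓ₀⁻¹ * ℓ) ≤ β) (ht : dist1 (T₀⁻¹ * T) ≤ t) :
    dist1 ((T₀ * ℓ₀ * T₀⁻¹)⁻¹ * (T * ℓ * T⁻¹)) ≤ β + 2 * τ * t := by
  refine (dist1_rel_conj_le hcomm ℓ ℓ₀ T T₀).trans (add_le_add hβ ?_)
  calc 2 * dist1 ℓ * dist1 (T₀⁻¹ * T) ≤ 2 * τ * t :=
      mul_le_mul (mul_le_mul_of_nonneg_left hℓ zero_le_two) ht (GaugeGroup.dist1_nonneg _) (by linarith [GaugeGroup.dist1_nonneg ℓ, hℓ])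
    _ = 2 * τ * t := rfl

/-- `δ(T·ℓ⁻¹·T⁻¹) ≤ δ(ℓ) + 2·dist1 ℓ·δ(T)` (the inverted member slots of the coupled word). [folklore] -/
theorem dist1_rel_conj_inv_le (hcomm : ∀ g h : G, dist1 (g * h * g⁻¹ * h⁻¹) ≤ 2 * dist1 g * dist1 h) {ℓ ℓ₀ T T₀ : G} {τ β t : ℝ}
    (hℓ : dist1 ℓ ≤ τ) (hβ : dist1 (ℓ₀⁻¹ * ℓ) ≤ β) (ht : dist1 (T₀⁻¹ * T) ≤ t) :
    dist1 ((T₀ * ℓ₀⁻¹ * T₀⁻¹)⁻¹ * (T * ℓ⁻¹ * T⁻¹)) ≤ β + 2 * τ * t := by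
  have hℓ' : dist1 ℓ⁻¹ ≤ τ := by rw [GaugeGroup.dist1_inv]; exact hℓ
  have hβ' : dist1 ((ℓ₀⁻¹)⁻¹ * ℓ⁻¹) ≤ β := by rw [dist1_rel_inv]; exact hβ
  exact dist1_rel_conj_le' hcomm hℓ' hβ' ht

/-- `δ(A₁A₂A₃⁻¹) ≤ δ(A₁) + δ(A₂) + δ(A₃)`. [folklore] -/
theorem dist1_rel_prod3_le (A₁ A₂ A₃ B₁ B₂ B₃ : G) :
    dist1 ((B₁ * B₂ * B₃⁻¹)⁻¹ * (A₁ * A₂ * A₃⁻¹)) ≤ dist1 (B₁⁻¹ * A₁) + dist1 (B₂⁻¹ * A₂) + dist1 (B₃⁻¹ * A₃) := by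
  refine (dist1_rel_mul_le _ _ _ _).trans (add_le_add (dist1_rel_mul_le _ _ _ _) ?_)
  rw [dist1_rel_inv]

/-- `δ(A₁A₂A₃⁻¹A₄⁻¹) ≤ δ(A₁) + δ(A₂) + δ(A₃) + δ(A₄)` (the context `H₀ = U(∂□_L(emb y))` of ✓G9's loop form). [folklore] -/
theorem dist1_rel_prod4_le (A₁ A₂ A₃ A₄ B₁ B₂ B₃ B₄ : G) :
    dist1 ((B₁ * B₂ * B₃⁻¹ * B₄⁻¹)⁻¹ * (A₁ * A₂ * A₃⁻¹ * A₄⁻¹)) ≤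
      dist1 (B₁⁻¹ * A₁) + dist1 (B₂⁻¹ * A₂) + dist1 (B₃⁻¹ * A₃) + dist1 (B₄⁻¹ * A₄) := by
  refine (dist1_rel_mul_le _ _ _ _).trans (add_le_add (dist1_rel_prod3_le _ _ _ _ _ _) ?_)
  rw [dist1_rel_inv]

end Group

/-! ## §3 The relative main term in log currency -/

section Main

variable {n : Type*} [Fintype n] [DecidableEq n] [Nonempty n]

/-- ★★ **THE RELATIVE MAIN TERM IN LOG CURRENCY** (`SU(N)`, standing range; `PlaqSmall θ U`, `PlaqSmall θ U₀`, `L²θ ≤ 1∕2`; relative staircase transports `δ(S_i) ≤ β`, forward-near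
bond deviations `≤ γ`): the member MEAN of `‖log(S_i□_iS_i⁻¹)(U) − log(S_i□_iS_i⁻¹)(U₀)‖` is at most `(1 + 2L²θ)·(Σ_p K Q p·δ_p + 4L³θ·γ + 2L²θ·β)` — `log` is `(1 + 2L²θ)`-Lipschitz on
the square loops, the relative conjugate square costs `δ(□_i) + 2·L²θ·β` (✓BRICK 1), and the member mean of `δ(□_i)` is px12's tent kernel on `δ_p` plus `4L³θγ` (✓BRICK 2).
[cite: Balaban1985Averaging, (19) p.21] -/
theorem mean_norm_mlog_conjRect_sub_le (hj : j + 1 ≤ P.m + P.K) (U U₀ : GaugeField P j (Matrix.specialUnitaryGroup n ℂ)) {θ : ℝ} (hθ0 : 0 ≤ θ)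
    (hLθ : (P.L : ℝ) ^ 2 * θ ≤ 1 / 2) (hU : PlaqSmall θ U) (hU₀ : PlaqSmall θ U₀) (Q : Plaq P (j + 1)) {β γ : ℝ}
    (hS : ∀ i : Idx P, dist1 ((holAt U₀ (walk (emb Q.src) (stairWord i.2.1 (off i.1))))⁻¹ * holAt U (walk (emb Q.src) (stairWord i.2.1 (off i.1)))) ≤ β)
    (hdev : ∀ c : PBond P j, (∀ κ, blockOf c.src κ = Q.src κ ∨ blockOf c.src κ = Q.src κ + 1) → dist1 (bdev U U₀ c) ≤ γ) :
    ((Fintype.card (Idx P) : ℝ))⁻¹ * ∑ i : Idx P,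
        ‖mlog ((holAt U (walk (emb Q.src) (stairWord i.2.1 (off i.1))) * rect U (Site.blockSite Q.src i.1) Q.μ Q.ν P.L P.L *
            (holAt U (walk (emb Q.src) (stairWord i.2.1 (off i.1))))⁻¹ : Matrix.specialUnitaryGroup n ℂ) : Matrix n n ℂ) -
          mlog ((holAt U₀ (walk (emb Q.src) (stairWord i.2.1 (off i.1))) * rect U₀ (Site.blockSite Q.src i.1) Q.μ Q.ν P.L P.L *
            (holAt U₀ (walk (emb Q.src) (stairWord i.2.1 (off i.1))))⁻¹ : Matrix.specialUnitaryGroup n ℂ) : Matrix n n ℂ)‖ ≤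
      (1 + 2 * ((P.L : ℝ) ^ 2 * θ)) *
        (∑ p : Plaq P j, ((P.L : ℝ) ^ P.d)⁻¹ * (((block Q.src).filter (fun x : Site P j => p.μ = Q.μ ∧ p.ν = Q.ν ∧
            ∃ a ∈ range P.L, ∃ b ∈ range P.L, p.src = shiftN (shiftN x Q.μ a) Q.ν b)).card : ℝ) *
            dist1 ((GaugeField.plaqHol U₀ p)⁻¹ * GaugeField.plaqHol U p) +
          4 * (P.L : ℝ) ^ 3 * θ * γ + 2 * ((P.L : ℝ) ^ 2 * θ) * β) := by
  set s : ℝ := (P.L : ℝ) ^ 2 * θ with hs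
  have hs0 : 0 ≤ s := by positivity
  -- per member: `log` Lipschitz, then the relative conjugate square
  have hR : ∀ (V : GaugeField P j (Matrix.specialUnitaryGroup n ℂ)), PlaqSmall θ V → ∀ i : Idx P,
      dist1 (holAt V (walk (emb Q.src) (stairWord i.2.1 (off i.1))) * rect V (Site.blockSite Q.src i.1) Q.μ Q.ν P.L P.L *
        (holAt V (walk (emb Q.src) (stairWord i.2.1 (off i.1))))⁻¹) ≤ s := fun V hV i => by
    rw [GaugeGroup.dist1_conj]; exact dist1_rect_le_sq_mul V hV _ Q.hμν
  have hmem : ∀ i : Idx P,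
      ‖mlog ((holAt U (walk (emb Q.src) (stairWord i.2.1 (off i.1))) * rect U (Site.blockSite Q.src i.1) Q.μ Q.ν P.L P.L *
            (holAt U (walk (emb Q.src) (stairWord i.2.1 (off i.1))))⁻¹ : Matrix.specialUnitaryGroup n ℂ) : Matrix n n ℂ) -
          mlog ((holAt U₀ (walk (emb Q.src) (stairWord i.2.1 (off i.1))) * rect U₀ (Site.blockSite Q.src i.1) Q.μ Q.ν P.L P.L *
            (holAt U₀ (walk (emb Q.src) (stairWord i.2.1 (off i.1))))⁻¹ : Matrix.specialUnitaryGroup n ℂ) : Matrix n n ℂ)‖ ≤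
        (1 + 2 * s) * (dist1 ((rect U₀ (Site.blockSite Q.src i.1) Q.μ Q.ν P.L P.L)⁻¹ * rect U (Site.blockSite Q.src i.1) Q.μ Q.ν P.L P.L) + 2 * s * β) := by
    intro i
    have hX := hR U hU i
    have hX₀ := hR U₀ hU₀ i
    -- `log` is `(1 + s∕(1−s))`-Lipschitz on `‖· − 1‖ ≤ s`, and `s∕(1−s) ≤ 2s`
    have hXn : ‖((holAt U (walk (emb Q.src) (stairWord i.2.1 (off i.1))) * rect U (Site.blockSite Q.src i.1) Q.μ Q.ν P.L P.L *
        (holAt U (walk (emb Q.src) (stairWord i.2.1 (off i.1))))⁻¹ : Matrix.specialUnitaryGroup n ℂ) : Matrix n n ℂ) - 1‖ ≤ s := by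
      rw [← FederbushMean.dist1_SU_eq]; exact hX
    have hX₀n : ‖((holAt U₀ (walk (emb Q.src) (stairWord i.2.1 (off i.1))) * rect U₀ (Site.blockSite Q.src i.1) Q.μ Q.ν P.L P.L *
        (holAt U₀ (walk (emb Q.src) (stairWord i.2.1 (off i.1))))⁻¹ : Matrix.specialUnitaryGroup n ℂ) : Matrix n n ℂ) - 1‖ ≤ s := by
      rw [← FederbushMean.dist1_SU_eq]; exact hX₀
    have hlog := FederbushMean.norm_mlog_sub_mlog_le (ρ := s) (by linarith) hXn hX₀n
    have hfac : 1 + s / (1 - s) ≤ 1 + 2 * s := by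
      have h1 : 0 < 1 - s := by linarith
      rw [add_le_add_iff_left, div_le_iff₀ h1]; nlinarith
    rw [norm_coe_sub_coe_eq_dist1_rel] at hlog
    have hsq : dist1 (rect U (Site.blockSite Q.src i.1) Q.μ Q.ν P.L P.L) ≤ s := dist1_rect_le_sq_mul U hU _ Q.hμν
    have hconj := dist1_rel_conj_le' dist1_comm_le_SU (ℓ₀ := rect U₀ (Site.blockSite Q.src i.1) Q.μ Q.ν P.L P.L) hsq le_rfl (hS i)
    have hd0 : 0 ≤ dist1 ((holAt U₀ (walk (emb Q.src) (stairWord i.2.1 (off i.1))) * rect U₀ (Site.blockSite Q.src i.1) Q.μ Q.ν P.L P.L *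
        (holAt U₀ (walk (emb Q.src) (stairWord i.2.1 (off i.1))))⁻¹)⁻¹ * (holAt U (walk (emb Q.src) (stairWord i.2.1 (off i.1))) *
          rect U (Site.blockSite Q.src i.1) Q.μ Q.ν P.L P.L * (holAt U (walk (emb Q.src) (stairWord i.2.1 (off i.1))))⁻¹)) := GaugeGroup.dist1_nonneg _
    calc _ ≤ (1 + s / (1 - s)) * _ := hlog
      _ ≤ (1 + 2 * s) * _ := mul_le_mul_of_nonneg_right hfac hd0
      _ ≤ (1 + 2 * s) * (dist1 ((rect U₀ (Site.blockSite Q.src i.1) Q.μ Q.ν P.L P.L)⁻¹ * rect U (Site.blockSite Q.src i.1) Q.μ Q.ν P.L P.L) + 2 * s * β) :=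
          mul_le_mul_of_nonneg_left hconj (by linarith)
  -- the member mean: ✓BRICK 2 with the local dev datum
  have hK := mean_dist1_rect_rel_le_tentKernel_of_local dist1_comm_le_SU hj U U₀ hθ0 (fun p => (hU p).le) Q hdev
  have hN : (0 : ℝ) < Fintype.card (Idx P) := Nat.cast_pos.mpr Fintype.card_pos
  calc ((Fintype.card (Idx P) : ℝ))⁻¹ * ∑ i : Idx P, _
      ≤ ((Fintype.card (Idx P) : ℝ))⁻¹ * ∑ i : Idx P,
          (1 + 2 * s) * (dist1 ((rect U₀ (Site.blockSite Q.src i.1) Q.μ Q.ν P.L P.L)⁻¹ * rect U (Site.blockSite Q.src i.1) Q.μ Q.ν P.L P.L) + 2 * s * β) :=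
        mul_le_mul_of_nonneg_left (Finset.sum_le_sum fun i _ => hmem i) (inv_nonneg.mpr hN.le)
    _ = (1 + 2 * s) * (((Fintype.card (Idx P) : ℝ))⁻¹ * ∑ i : Idx P,
          dist1 ((rect U₀ (Site.blockSite Q.src i.1) Q.μ Q.ν P.L P.L)⁻¹ * rect U (Site.blockSite Q.src i.1) Q.μ Q.ν P.L P.L) + 2 * s * β) := by
        have hsum : ∑ i : Idx P, (1 + 2 * s) * (dist1 ((rect U₀ (Site.blockSite Q.src i.1) Q.μ Q.ν P.L P.L)⁻¹ * rect U (Site.blockSite Q.src i.1) Q.μ Q.ν P.L P.L) + 2 * s * β) =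
            (1 + 2 * s) * (∑ i : Idx P, dist1 ((rect U₀ (Site.blockSite Q.src i.1) Q.μ Q.ν P.L P.L)⁻¹ * rect U (Site.blockSite Q.src i.1) Q.μ Q.ν P.L P.L) +
              (Fintype.card (Idx P) : ℝ) * (2 * s * β)) := by
          rw [← Finset.mul_sum, Finset.sum_add_distrib, Finset.sum_const, Finset.card_univ, nsmul_eq_mul]
        rw [hsum]
        field_simp
    _ ≤ (1 + 2 * s) * (_ + 4 * (P.L : ℝ) ^ 3 * θ * γ + 2 * s * β) := by
        refine mul_le_mul_of_nonneg_left ?_ (by linarith)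
        linarith [hK]

end Main

end Summit.QuantumFields.YangMills.Theorems.FluctuationComparisonRegPrIntLS2BetaRelativeMemberLetters

end
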